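import Mathlib

/-!
# Monomial substitutions with injective exponent map are injective (generic)

(crux stmt-ResolutionOfSingularities-15640 `WildQuotients.WildQuotientResolution`, line `Sketch`,
sector `|G| = p`; programme V4U of `L/w45c/CHAIN.md` v5 — the root substitutions of the toric exit
charts (stub-4 FINDING V4U-μ₃/μ₂-EXIT; generalises stub-2's `ToricExit.monomialTwist_injective`,
whose exponent matrices are triangular, to arbitrary nonsingular ones such as
`y ↦ (z₂z₃², z₁z₂z₃², z₂²z₃)` of the chart `D₊(y₁y₃ t)`). [OURS · L1 W4.5c] — NOT a statement of any
manuscript; replaces the role of no printed item. Prover res-L1-w45c-stub-4.)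

* `aeval_monomial_injective` — if `e ↦ Σᵢ eᵢ • Mᵢ` is injective on exponent vectors, the
  `k`-algebra endomorphism `X i ↦ X^{Mᵢ}` of `k[x₁,…,xₙ]` is injective (it is
  `Finsupp.mapDomain` of that exponent map on the monoid algebra).
-/

-- single-problem summit: the doubled namespace component `ResolutionOfSingularities` is forced
set_option linter.dupNamespace false

noncomputable section

open MvPolynomial

namespace Summit.ResolutionOfSingularities.ResolutionOfSingularities.Theorems.WildQuotientResolution.MonomialMap

/-- **A monomial substitution with injective exponent map is injective**: for `M : σ → (σ →₀ ℕ)`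
with `e ↦ Σᵢ eᵢ • Mᵢ` injective, `aeval (X^{M i})` is injective — it is `Finsupp.mapDomain` of the
exponent map on the monoid algebra `k[ℕ^σ]`. [folklore] -/
theorem aeval_monomial_injective {k : Type} [Field k] {σ : Type} (M : σ → (σ →₀ ℕ))
    (hL : Function.Injective (fun e : σ →₀ ℕ => e.sum fun i n => n • M i)) :
    Function.Injective (MvPolynomial.aeval (R := k) (fun i => monomial (M i) (1 : k))) := by
  classical
  let L : (σ →₀ ℕ) →+ (σ →₀ ℕ) :=
    (Finsupp.linearCombination ℕ M : (σ →₀ ℕ) →ₗ[ℕ] (σ →₀ ℕ)).toAddMonoidHom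
  have hL' : ∀ e : σ →₀ ℕ, L e = e.sum fun i n => n • M i := fun e => by
    simp [L, Finsupp.linearCombination_apply]
  have hLinj : Function.Injective L := by
    intro e e' h
    apply hL
    change (e.sum fun i n => n • M i) = e'.sum fun i n => n • M i
    rw [← hL', ← hL', h]
  let Φ : MvPolynomial σ k →ₐ[k] MvPolynomial σ k := AddMonoidAlgebra.mapDomainAlgHom k k L
  have hΦ : ∀ g : MvPolynomial σ k, Φ g = AddMonoidAlgebra.mapDomain L g := fun g => by
    simp [Φ]
  have hΦinj : Function.Injective Φ := by
    intro f g h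
    rw [hΦ, hΦ] at h
    exact AddMonoidAlgebra.mapDomain_injective hLinj h
  have key : MvPolynomial.aeval (R := k) (fun i => monomial (M i) (1 : k)) = Φ := by
    refine MvPolynomial.algHom_ext fun i => ?_
    rw [aeval_X, hΦ]
    have hX : (X i : MvPolynomial σ k) = AddMonoidAlgebra.single (Finsupp.single i 1) (1 : k) := rfl
    rw [hX, AddMonoidAlgebra.mapDomain_single, hL', Finsupp.sum_single_index (zero_smul ℕ (M i)),
      one_smul, MvPolynomial.single_eq_monomial]
  rw [key]
  exact hΦinj

end Summit.ResolutionOfSingularities.ResolutionOfSingularities.Theorems.WildQuotientResolution.MonomialMap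

end
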